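import Summits.QuantumFields.YangMills.Theorems.BalabanUVNodesN15KingModelAnalyticBlockTerm
import Summits.QuantumFields.YangMills.Theorems.BalabanUVNodesN15KingModelCombesThomasLipschitz
import HarnessLib

/-!
# BalabanUVNodes ∕ N15 — THE KING-MODEL RUNG (PART Ϩ-d): THE COVARIANT BLOCK TERM UNDER A COMPLEX PERTURBATION OF THE LINK FIELD — transports along contours of depth `≤ D` of a
# field `ε`-close (bondwise, NOT necessarily unitary) to a unitary `U₀` grow at most like `(1+ε)^D` and move by at most `(1+ε)^D − 1`; the block term `aL^{d+1}Q♯(V)Q(U)` moves by at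
# most `a·((1+ε)^{2D} − 1)` in operator norm, and by `e^{ϑ}·a·((1+ε)^{2D} − 1)` after a weight conjugation of block oscillation `ϑ`
# (Track A, DAG node N15 = NE2; FAN-OUT v1.1 §N15 s3 «KING-MODEL RUNG … + what the curved case adds»; count-neutral)

HONEST FRAMING.  Count-neutral (cell `pub-ymgap`, seat `pub-ymgap-dag-n15-e` g51; `--supports stmt-QuantumFields-27247 --as helper` = K3ᴬ, KEY MAP v3).  Elementary telescoping on King's
fine torus with a tree contour system (PART Ϥ-b∕Ϩ-a objects); the block Schur test of PART Ϛ-l∕Ϧ-f.  For the comb `D = (d+1)(L−1)`, so on BAŁABAN's SCALE `ε = s∕L` the motion is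
`(1 + s∕L)^{2(d+1)(L−1)} − 1 ≤ e^{2(d+1)s} − 1 = O(s)` — `η`-UNIFORM (PART Ϩ-e does this bookkeeping).  NOT Bałaban's multi-level `G_k(U)`; NOT a node discharge; nothing continuum ∕ Clay.

THE RESULTS (`T` a tree contour system with `depth ≤ D`, `M` the block torus, `U₀` UNITARY, `U, V` ANY fields with `‖U_b − U₀_b‖ ≤ ε`, `‖V_b − U₀_bᴴ‖ ≤ ε` on every bond):
* §1 `norm_treeHol_le_pow` (`‖U(Γ_{y,x_j})‖ ≤ (1+ε)^{depth j}`), ★ `norm_treeHol_sub_le_pow` (`‖U(Γ) − U₀(Γ)‖ ≤ (1+ε)^{depth j} − 1`), ★ `norm_treeHolRev_sub_le_pow` (`‖V(Γ_{x,y}) − U₀(Γ_{y,x})ᴴ‖ ≤ (1+ε)^{depth j} − 1`),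
  `norm_treeHolRev_le_pow`, ★★ **`norm_transportPair_sub_le`** (`‖V(Γ_{x,y})U(Γ_{y,x′}) − U₀(Γ_{y,x})ᴴU₀(Γ_{y,x′})‖ ≤ (1+ε)^{2D} − 1`).
* §2 ★ `blk_smul_sub'`, ★★ **`norm_blk_cxBlockTerm_sub_le`** (`‖blk (aL^{d+1}(Q♯(V)Q(U) − Q♯(U₀ᴴ)Q(U₀))) x x′‖ ≤ [same block]·aL^{−(d+1)}·((1+ε)^{2D} − 1)`, `a ≥ 0`).
* §3 ★★★ **`l2_opNorm_wtConj_cxBlockTerm_sub_le`** (block oscillation `|φ(x) − φ(x′)| ≤ ϑ` on blocks ⟹ `‖(aL^{d+1}(Q♯(V)Q(U) − Q♯(U₀ᴴ)Q(U₀)))_φ‖ ≤ e^{ϑ}·a·((1+ε)^{2D} − 1)`), `wtConj_const_zero'`,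
  ★★ **`l2_opNorm_cxBlockTerm_sub_le`** (unweighted: `≤ a((1+ε)^{2D} − 1)`), ★★ `l2_opNorm_wtConj_cxBlockTerm_sub_le_ctW` (the tree weight `ctW`: `ϑ = κ_w`).
PRIOR TREE ART (by name): Ϩ-a (`treeHolRev`, `cxQadj`, `blk_cxGram_site`, `treeHol_conjTranspose`, `treeHolRev_conjTranspose`), Ϥ-b (`treeHol`, induction), Ϥ-c (`covQ`), Ϧ-f
(`l2_opNorm_wtConj_le_of_blk_symm`), Ϛ-l (`l2_opNorm_le_of_blk_symm`), Ϧ-a (`wtConj`), Ͱ-q (`l2_opNorm_of_mem_unitaryGroup_le`), `King1986.Torus` (`blockEquiv`, `blockOf_site`, `abs_ctW_block_le`), Mathlib.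
Dedup (rg at filing): basename 0 files; needles `norm_treeHol_sub_le_pow|norm_transportPair_sub_le|cxBlockTerm` 0 tree files (Ϥ-h `norm_treeHol_sub_le` is the unitary–unitary linear bound `Dκ`;
here one field is non-unitary and the bound is geometric).  presearch: n/a (telescoping of products; folklore).  Locators: [Balaban1985BackgroundPropagators] (3.19) p.393, (3.24) p.394, §3.B p.399 l.37–40,
(3.50)–(3.53) p.400; [King1986] (2.11)–(2.13) p.653.  0 `sorry`, 0 `def`.
-/

noncomputable section
open scoped BigOperators ComplexConjugate Matrix.Norms.L2Operator
open Finset Matrix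

namespace Summit.QuantumFields.YangMills.BalabanUVNodes.N15KingModelRung.Analytic

open Literature.MathematicalPhysics.QuantumFieldTheory.LatticeDiamagneticInequality (blk)
open Literature.MathematicalPhysics.QuantumFieldTheory.Balaban1983to89.B5Prop11Plancherel (Tor fine unitVec)
open Literature.MathematicalPhysics.QuantumFieldTheory.King1986.Torus (site blockOf blockOf_site blockEquiv blockEquiv_apply ctW abs_ctW_block_le)
open Summit.QuantumFields.YangMills.BalabanUVNodes.N15KingModelRung.Covariant (l2_opNorm_of_mem_unitaryGroup_le l2_opNorm_le_of_blk_symm)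
open Summit.QuantumFields.YangMills.BalabanUVNodes.N15KingModelRung.CovariantBlock (BlockTree treeHol treeHol_root treeHol_of_ne_root treeHol_mem_unitaryGroup covQ)
open Summit.QuantumFields.YangMills.BalabanUVNodes.N15KingModelRung.CombesThomas (wtConj wtConj_apply l2_opNorm_wtConj_le_of_blk_symm)

variable {d : ℕ} {L : ℕ} [NeZero L] (T : BlockTree d L) (M : Fin (d + 1) → ℕ) [hM : ∀ μ, NeZero (M μ)]
variable {𝕜 : Type*} [RCLike 𝕜] {n : Type*} [Fintype n] [DecidableEq n]

/-! ## §1 Transports of a field close to a unitary field -/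

section Transport

variable {U₀ U V : Tor (fine L M) × Fin (d + 1) → Matrix n n 𝕜} (hU₀ : ∀ bd, U₀ bd ∈ Matrix.unitaryGroup n 𝕜) {ε : ℝ} (hε0 : 0 ≤ ε)

omit hM in
/-- A GEOMETRIC BOUND ALONG THE CONTOUR: `‖U_b‖ ≤ 1+ε` on every bond ⟹ `‖U(Γ_{y,x_j})‖ ≤ (1+ε)^{depth j}`. [cite: Balaban1985BackgroundPropagators, (3.19) p.393] -/
theorem norm_treeHol_le_pow (hε0 : 0 ≤ ε) (hU : ∀ bd, ‖U bd‖ ≤ 1 + ε) (b : Tor M) : ∀ j, ‖treeHol M T U b j‖ ≤ (1 + ε) ^ T.depth j := by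
  refine T.induction (P := fun j => ‖treeHol M T U b j‖ ≤ (1 + ε) ^ T.depth j) ?_ fun j hj ih => ?_
  · rw [treeHol_root, T.depth_root, pow_zero, Matrix.cstar_norm_def, map_one]; exact ContinuousLinearMap.norm_id_le
  · rw [treeHol_of_ne_root T M U b hj, ← T.depth_parent j hj, pow_succ]
    exact (norm_mul_le _ _).trans (mul_le_mul ih (hU _) (norm_nonneg _) (pow_nonneg (by linarith) _))

include hU₀ in
omit hM in
/-- ★ **THE TRANSPORT OF A PERTURBED FIELD**: `‖U_b − U₀_b‖ ≤ ε` (unitary `U₀`, ANY `U`) ⟹ `‖U(Γ_{y,x_j}) − U₀(Γ_{y,x_j})‖ ≤ (1+ε)^{depth j} − 1`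
(one bond at a time: `H_pU_b − H⁰_pU⁰_b = (H_p − H⁰_p)U_b + H⁰_p(U_b − U⁰_b)`). [cite: Balaban1985BackgroundPropagators, (3.19) p.393, (3.50) p.400] -/
theorem norm_treeHol_sub_le_pow (hε0 : 0 ≤ ε) (hU : ∀ bd, ‖U bd - U₀ bd‖ ≤ ε) (b : Tor M) : ∀ j, ‖treeHol M T U b j - treeHol M T U₀ b j‖ ≤ (1 + ε) ^ T.depth j - 1 := by
  have hU1 : ∀ bd, ‖U bd‖ ≤ 1 + ε := fun bd => by
    calc ‖U bd‖ = ‖U₀ bd + (U bd - U₀ bd)‖ := by rw [add_sub_cancel]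
      _ ≤ ‖U₀ bd‖ + ‖U bd - U₀ bd‖ := norm_add_le _ _
      _ ≤ 1 + ε := add_le_add (l2_opNorm_of_mem_unitaryGroup_le (hU₀ bd)) (hU bd)
  refine T.induction (P := fun j => ‖treeHol M T U b j - treeHol M T U₀ b j‖ ≤ (1 + ε) ^ T.depth j - 1) ?_ fun j hj ih => ?_
  · rw [treeHol_root, treeHol_root, sub_self, norm_zero, T.depth_root, pow_zero, sub_self]
  · rw [treeHol_of_ne_root T M U b hj, treeHol_of_ne_root T M U₀ b hj, ← T.depth_parent j hj]
    have hk : (1 : ℝ) ≤ (1 + ε) ^ T.depth (T.parent j) := one_le_pow₀ (by linarith)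
    have hsplit : treeHol M T U b (T.parent j) * U (site L M b (T.parent j), T.axis j) - treeHol M T U₀ b (T.parent j) * U₀ (site L M b (T.parent j), T.axis j)
        = (treeHol M T U b (T.parent j) - treeHol M T U₀ b (T.parent j)) * U (site L M b (T.parent j), T.axis j)
          + treeHol M T U₀ b (T.parent j) * (U (site L M b (T.parent j), T.axis j) - U₀ (site L M b (T.parent j), T.axis j)) := by
      rw [Matrix.sub_mul, Matrix.mul_sub]; abel
    rw [hsplit]
    calc _ ≤ ‖treeHol M T U b (T.parent j) - treeHol M T U₀ b (T.parent j)‖ * ‖U (site L M b (T.parent j), T.axis j)‖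
            + ‖treeHol M T U₀ b (T.parent j)‖ * ‖U (site L M b (T.parent j), T.axis j) - U₀ (site L M b (T.parent j), T.axis j)‖ :=
          (norm_add_le _ _).trans (add_le_add (norm_mul_le _ _) (norm_mul_le _ _))
      _ ≤ ((1 + ε) ^ T.depth (T.parent j) - 1) * (1 + ε) + 1 * ε :=
          add_le_add (mul_le_mul ih (hU1 _) (norm_nonneg _) (by linarith))
            (mul_le_mul (l2_opNorm_of_mem_unitaryGroup_le (treeHol_mem_unitaryGroup T M hU₀ b _)) (hU _) (norm_nonneg _) zero_le_one)
      _ = (1 + ε) ^ (T.depth (T.parent j) + 1) - 1 := by rw [pow_succ]; ring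

include hU₀ in
omit hM in
/-- `‖U(Γ_{y,x_j})‖ ≤ (1+ε)^{depth j}` for `U` within `ε` of the unitary `U₀`. [cite: Balaban1985BackgroundPropagators, (3.19) p.393] -/
theorem norm_treeHol_le_pow_of_near (hε0 : 0 ≤ ε) (hU : ∀ bd, ‖U bd - U₀ bd‖ ≤ ε) (b : Tor M) (j : Fin (d + 1) → Fin L) : ‖treeHol M T U b j‖ ≤ (1 + ε) ^ T.depth j := by
  have h := norm_treeHol_sub_le_pow T M hU₀ hε0 hU b j
  calc ‖treeHol M T U b j‖ = ‖treeHol M T U₀ b j + (treeHol M T U b j - treeHol M T U₀ b j)‖ := by rw [add_sub_cancel]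
    _ ≤ ‖treeHol M T U₀ b j‖ + ‖treeHol M T U b j - treeHol M T U₀ b j‖ := norm_add_le _ _
    _ ≤ 1 + ((1 + ε) ^ T.depth j - 1) := add_le_add (l2_opNorm_of_mem_unitaryGroup_le (treeHol_mem_unitaryGroup T M hU₀ b j)) h
    _ = (1 + ε) ^ T.depth j := by ring

include hU₀ in
omit hM in
/-- ★ **THE REVERSED TRANSPORT OF A PERTURBED BACKWARD FIELD**: `‖V_b − U₀_bᴴ‖ ≤ ε` ⟹ `‖V(Γ_{x_j,y}) − U₀(Γ_{y,x_j})ᴴ‖ ≤ (1+ε)^{depth j} − 1` (via `V(Γ_{x,y}) = (Vᴴ(Γ_{y,x}))ᴴ`, Ϩ-a).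
[cite: Balaban1985BackgroundPropagators, (3.19) p.393, §3.B p.399 l.37–40] -/
theorem norm_treeHolRev_sub_le_pow (hε0 : 0 ≤ ε) (hV : ∀ bd, ‖V bd - (U₀ bd)ᴴ‖ ≤ ε) (b : Tor M) (j : Fin (d + 1) → Fin L) :
    ‖treeHolRev M T V b j - (treeHol M T U₀ b j)ᴴ‖ ≤ (1 + ε) ^ T.depth j - 1 := by
  have hV' : ∀ bd, ‖(fun bd => (V bd)ᴴ) bd - U₀ bd‖ ≤ ε := fun bd => by
    have : (V bd)ᴴ - U₀ bd = (V bd - (U₀ bd)ᴴ)ᴴ := by rw [conjTranspose_sub, conjTranspose_conjTranspose]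
    rw [this, Matrix.l2_opNorm_conjTranspose]; exact hV bd
  have h := norm_treeHol_sub_le_pow T M hU₀ hε0 hV' b j
  have e : treeHolRev M T V b j - (treeHol M T U₀ b j)ᴴ = (treeHol M T (fun bd => (V bd)ᴴ) b j - treeHol M T U₀ b j)ᴴ := by
    rw [conjTranspose_sub, ← treeHolRev_conjTranspose T M V b j, conjTranspose_conjTranspose]
  rw [e, Matrix.l2_opNorm_conjTranspose]; exact h

include hU₀ in
omit hM in
/-- `‖V(Γ_{x_j,y})‖ ≤ (1+ε)^{depth j}`. [cite: Balaban1985BackgroundPropagators, (3.19) p.393] -/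
theorem norm_treeHolRev_le_pow_of_near (hε0 : 0 ≤ ε) (hV : ∀ bd, ‖V bd - (U₀ bd)ᴴ‖ ≤ ε) (b : Tor M) (j : Fin (d + 1) → Fin L) : ‖treeHolRev M T V b j‖ ≤ (1 + ε) ^ T.depth j := by
  have h := norm_treeHolRev_sub_le_pow T M hU₀ hε0 hV b j
  have h0 : ‖(treeHol M T U₀ b j)ᴴ‖ ≤ 1 := by rw [Matrix.l2_opNorm_conjTranspose]; exact l2_opNorm_of_mem_unitaryGroup_le (treeHol_mem_unitaryGroup T M hU₀ b j)
  calc ‖treeHolRev M T V b j‖ = ‖(treeHol M T U₀ b j)ᴴ + (treeHolRev M T V b j - (treeHol M T U₀ b j)ᴴ)‖ := by rw [add_sub_cancel]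
    _ ≤ ‖(treeHol M T U₀ b j)ᴴ‖ + ‖treeHolRev M T V b j - (treeHol M T U₀ b j)ᴴ‖ := norm_add_le _ _
    _ ≤ 1 + ((1 + ε) ^ T.depth j - 1) := add_le_add h0 h
    _ = (1 + ε) ^ T.depth j := by ring

include hU₀ in
omit hM in
/-- ★★ **THE TRANSPORT PAIR THROUGH THE CORNER MOVES GEOMETRICALLY**: contours of depth `≤ D`, `‖U_b − U₀_b‖ ≤ ε`, `‖V_b − U₀_bᴴ‖ ≤ ε` ⟹
`‖V(Γ_{x_j,y})U(Γ_{y,x_{j′}}) − U₀(Γ_{y,x_j})ᴴU₀(Γ_{y,x_{j′}})‖ ≤ (1+ε)^{2D} − 1` (`(r^D − 1)r^D + (r^D − 1) = r^{2D} − 1`). [cite: Balaban1985BackgroundPropagators, (3.24) p.394, (3.50) p.400] -/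
theorem norm_transportPair_sub_le {D : ℕ} (hD : ∀ j, T.depth j ≤ D) (hε0 : 0 ≤ ε) (hU : ∀ bd, ‖U bd - U₀ bd‖ ≤ ε) (hV : ∀ bd, ‖V bd - (U₀ bd)ᴴ‖ ≤ ε) (b : Tor M)
    (j j' : Fin (d + 1) → Fin L) :
    ‖treeHolRev M T V b j * treeHol M T U b j' - (treeHol M T U₀ b j)ᴴ * treeHol M T U₀ b j'‖ ≤ (1 + ε) ^ (2 * D) - 1 := by
  have hr : (1 : ℝ) ≤ 1 + ε := by linarith
  have hRj : ‖treeHolRev M T V b j - (treeHol M T U₀ b j)ᴴ‖ ≤ (1 + ε) ^ D - 1 :=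
    (norm_treeHolRev_sub_le_pow T M hU₀ hε0 hV b j).trans (sub_le_sub_right (pow_le_pow_right₀ hr (hD j)) 1)
  have hHj' : ‖treeHol M T U b j' - treeHol M T U₀ b j'‖ ≤ (1 + ε) ^ D - 1 :=
    (norm_treeHol_sub_le_pow T M hU₀ hε0 hU b j').trans (sub_le_sub_right (pow_le_pow_right₀ hr (hD j')) 1)
  have hH : ‖treeHol M T U b j'‖ ≤ (1 + ε) ^ D := (norm_treeHol_le_pow_of_near T M hU₀ hε0 hU b j').trans (pow_le_pow_right₀ hr (hD j'))
  have h0 : ‖(treeHol M T U₀ b j)ᴴ‖ ≤ 1 := by rw [Matrix.l2_opNorm_conjTranspose]; exact l2_opNorm_of_mem_unitaryGroup_le (treeHol_mem_unitaryGroup T M hU₀ b j)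
  have hpos : (0 : ℝ) ≤ (1 + ε) ^ D - 1 := sub_nonneg.2 (one_le_pow₀ hr)
  have hsplit : treeHolRev M T V b j * treeHol M T U b j' - (treeHol M T U₀ b j)ᴴ * treeHol M T U₀ b j'
      = (treeHolRev M T V b j - (treeHol M T U₀ b j)ᴴ) * treeHol M T U b j' + (treeHol M T U₀ b j)ᴴ * (treeHol M T U b j' - treeHol M T U₀ b j') := by
    rw [Matrix.sub_mul, Matrix.mul_sub]; abel
  rw [hsplit]
  calc _ ≤ ‖treeHolRev M T V b j - (treeHol M T U₀ b j)ᴴ‖ * ‖treeHol M T U b j'‖ + ‖(treeHol M T U₀ b j)ᴴ‖ * ‖treeHol M T U b j' - treeHol M T U₀ b j'‖ :=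
        (norm_add_le _ _).trans (add_le_add (norm_mul_le _ _) (norm_mul_le _ _))
    _ ≤ ((1 + ε) ^ D - 1) * (1 + ε) ^ D + 1 * ((1 + ε) ^ D - 1) :=
        add_le_add (mul_le_mul hRj hH (norm_nonneg _) hpos) (mul_le_mul h0 hHj' (norm_nonneg _) zero_le_one)
    _ = (1 + ε) ^ (2 * D) - 1 := by rw [two_mul, pow_add]; ring

end Transport

/-! ## §2 The fibre blocks of the perturbed block term -/

section Blocks

omit [NeZero L] hM [Fintype n] [DecidableEq n] in
/-- Blocks are linear: `blk (r•(X − Y)) x x′ = r•(blk X x x′ − blk Y x x′)`. [folklore] -/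
theorem blk_smul_sub' (r : 𝕜) (X Y : Matrix (Tor (fine L M) × n) (Tor (fine L M) × n) 𝕜) (x x' : Tor (fine L M)) : blk (r • (X - Y)) x x' = r • (blk X x x' - blk Y x x') := by
  ext k k'; simp only [blk, Matrix.of_apply, Matrix.smul_apply, Matrix.sub_apply, smul_eq_mul]

/-- ★★ **THE BLOCKS OF THE PERTURBED BLOCK TERM**: for unitary `U₀`, `‖U_b − U₀_b‖ ≤ ε`, `‖V_b − U₀_bᴴ‖ ≤ ε`, contours of depth `≤ D`, `a ≥ 0`:
`‖blk (aL^{d+1}(Q♯(V)Q(U) − Q♯(U₀ᴴ)Q(U₀))) x x′‖ ≤ [blockOf x = blockOf x′]·aL^{−(d+1)}·((1+ε)^{2D} − 1)`. [cite: Balaban1985BackgroundPropagators, (3.24) p.394, (3.50) p.400; King1986, (2.13) p.653] -/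
theorem norm_blk_cxBlockTerm_sub_le {D : ℕ} (hD : ∀ j, T.depth j ≤ D) {a : ℝ} (ha : 0 ≤ a) {U₀ U V : Tor (fine L M) × Fin (d + 1) → Matrix n n 𝕜} (hU₀ : ∀ bd, U₀ bd ∈ Matrix.unitaryGroup n 𝕜)
    {ε : ℝ} (hε0 : 0 ≤ ε) (hU : ∀ bd, ‖U bd - U₀ bd‖ ≤ ε) (hV : ∀ bd, ‖V bd - (U₀ bd)ᴴ‖ ≤ ε) (x x' : Tor (fine L M)) :
    ‖blk (((a * (L : ℝ) ^ (d + 1) : ℝ) : 𝕜) • (cxQadj T M V * covQ T M U - cxQadj T M (fun bd => (U₀ bd)ᴴ) * covQ T M U₀)) x x'‖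
      ≤ if blockOf L M x = blockOf L M x' then a * ((L : ℝ) ^ (d + 1))⁻¹ * ((1 + ε) ^ (2 * D) - 1) else 0 := by
  have hL0 : (0 : ℝ) < (L : ℝ) ^ (d + 1) := by have : (0 : ℝ) < L := (by exact_mod_cast Nat.pos_of_ne_zero (NeZero.ne L)); positivity
  obtain ⟨⟨β, j⟩, rfl⟩ := (blockEquiv L M).surjective x
  obtain ⟨⟨β', j'⟩, rfl⟩ := (blockEquiv L M).surjective x'
  simp only [blockEquiv_apply, blockOf_site]
  rw [blk_smul_sub', blk_cxGram_site, blk_cxGram_site]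
  by_cases h : β = β'
  · subst h
    rw [if_pos rfl, if_pos rfl, if_pos rfl, ← smul_sub, smul_smul, norm_smul, ← treeHol_conjTranspose T M U₀ β j]
    have hsc : ‖(((a * (L : ℝ) ^ (d + 1) : ℝ)) : 𝕜) * ((((L : ℝ) ^ (d + 1))⁻¹ ^ 2 : ℝ) : 𝕜)‖ = a * ((L : ℝ) ^ (d + 1))⁻¹ := by
      rw [← RCLike.ofReal_mul, RCLike.norm_ofReal, abs_of_nonneg (by positivity)]; field_simp
    rw [hsc]
    exact mul_le_mul_of_nonneg_left (norm_transportPair_sub_le T M hU₀ hD hε0 hU hV β j j') (by positivity)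
  · rw [if_neg h, if_neg h, if_neg h, sub_zero, smul_zero, norm_zero]

end Blocks

/-! ## §3 Operator norms: plain and weight-conjugated -/

section Operator

/-- ★★★ **THE WEIGHT-CONJUGATED PERTURBATION OF THE BLOCK TERM**: for a weight `φ` with block oscillation `|φ(x) − φ(x′)| ≤ ϑ` (same block), unitary `U₀`, `‖U_b − U₀_b‖ ≤ ε`,
`‖V_b − U₀_bᴴ‖ ≤ ε`, contours of depth `≤ D`, `a ≥ 0`:  `‖(aL^{d+1}(Q♯(V)Q(U) − Q♯(U₀ᴴ)Q(U₀)))_φ‖ ≤ e^{ϑ}·a·((1+ε)^{2D} − 1)` (weighted block Schur test: `L^{d+1}` sites per block).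
[cite: Balaban1985BackgroundPropagators, (3.24) p.394, (3.48)–(3.50) pp.398–400 (shape); King1986, (2.13) p.653] -/
theorem l2_opNorm_wtConj_cxBlockTerm_sub_le {D : ℕ} (hD : ∀ j, T.depth j ≤ D) {a : ℝ} (ha : 0 ≤ a) {U₀ U V : Tor (fine L M) × Fin (d + 1) → Matrix n n 𝕜}
    (hU₀ : ∀ bd, U₀ bd ∈ Matrix.unitaryGroup n 𝕜) {ε : ℝ} (hε0 : 0 ≤ ε) (hU : ∀ bd, ‖U bd - U₀ bd‖ ≤ ε) (hV : ∀ bd, ‖V bd - (U₀ bd)ᴴ‖ ≤ ε)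
    {φ : Tor (fine L M) → ℝ} {ϑ : ℝ} (hϑ : ∀ x x', blockOf L M x = blockOf L M x' → |φ x - φ x'| ≤ ϑ) :
    ‖wtConj (fine L M) φ ((((a * (L : ℝ) ^ (d + 1) : ℝ)) : 𝕜) • (cxQadj T M V * covQ T M U - cxQadj T M (fun bd => (U₀ bd)ᴴ) * covQ T M U₀))‖
      ≤ Real.exp ϑ * (a * ((1 + ε) ^ (2 * D) - 1)) := by
  have hL0 : (0 : ℝ) < (L : ℝ) ^ (d + 1) := by have : (0 : ℝ) < L := (by exact_mod_cast Nat.pos_of_ne_zero (NeZero.ne L)); positivity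
  have hτ : (0 : ℝ) ≤ (1 + ε) ^ (2 * D) - 1 := sub_nonneg.2 (one_le_pow₀ (by linarith))
  set τ : ℝ := a * ((1 + ε) ^ (2 * D) - 1) with hτdef
  have hτ0 : 0 ≤ τ := mul_nonneg ha hτ
  set b : Tor (fine L M) → Tor (fine L M) → ℝ := fun x x' => if blockOf L M x = blockOf L M x' then ((L : ℝ) ^ (d + 1))⁻¹ * τ else 0 with hb
  have hbsymm : ∀ x x', b x' x = b x x' := fun x x' => by simp only [hb, eq_comm]
  have hblk : ∀ x x', ‖blk ((((a * (L : ℝ) ^ (d + 1) : ℝ)) : 𝕜) • (cxQadj T M V * covQ T M U - cxQadj T M (fun bd => (U₀ bd)ᴴ) * covQ T M U₀)) x x'‖ ≤ b x x' := by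
    intro x x'
    refine (norm_blk_cxBlockTerm_sub_le T M hD ha hU₀ hε0 hU hV x x').trans (le_of_eq ?_)
    simp only [hb, hτdef]
    split_ifs <;> ring
  have hwt : ∀ x x', Real.exp |φ x - φ x'| * b x x' ≤ Real.exp ϑ * b x x' := by
    intro x x'
    by_cases h : blockOf L M x = blockOf L M x'
    · exact mul_le_mul_of_nonneg_right (Real.exp_le_exp.mpr (hϑ x x' h)) (by simp only [hb]; positivity)
    · simp only [hb, if_neg h, mul_zero, le_refl]
  have hrow : ∀ x, ∑ x', b x x' = τ := by
    intro x
    rw [← (blockEquiv L M).sum_comp, Fintype.sum_prod_type]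
    simp only [hb, blockEquiv_apply, blockOf_site]
    rw [Finset.sum_eq_single (blockOf L M x)]
    · simp only [if_true, Finset.sum_const, Finset.card_univ, Fintype.card_fun, Fintype.card_fin, nsmul_eq_mul]
      push_cast; field_simp
    · intro b' _ hb'; exact Finset.sum_eq_zero fun j _ => by rw [if_neg (Ne.symm hb')]
    · intro h; exact absurd (Finset.mem_univ _) h
  refine l2_opNorm_wtConj_le_of_blk_symm (fine L M) φ hblk (R := Real.exp ϑ * τ) ?_ ?_
  · intro x
    calc ∑ x', Real.exp |φ x - φ x'| * b x x' ≤ ∑ x', Real.exp ϑ * b x x' := Finset.sum_le_sum fun x' _ => hwt x x'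
      _ = Real.exp ϑ * τ := by rw [← Finset.mul_sum, hrow]
  · intro x'
    calc ∑ x, Real.exp |φ x - φ x'| * b x x' ≤ ∑ x, Real.exp ϑ * b x x' := Finset.sum_le_sum fun x _ => hwt x x'
      _ = Real.exp ϑ * τ := by
          rw [← Finset.mul_sum]; congr 1
          rw [show ∑ x, b x x' = ∑ x, b x' x from Finset.sum_congr rfl fun x _ => hbsymm x' x ▸ rfl, hrow]

omit [NeZero L] hM [Fintype n] [DecidableEq n] in
/-- The zero weight does not conjugate. [folklore] -/
theorem wtConj_const_zero' (X : Matrix (Tor (fine L M) × n) (Tor (fine L M) × n) 𝕜) : wtConj (fine L M) (fun _ => (0 : ℝ)) X = X := by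
  ext p q; rw [wtConj_apply, sub_self, Real.exp_zero, RCLike.ofReal_one, one_mul]

/-- ★★ **THE PLAIN OPERATOR NORM OF THE PERTURBATION OF THE BLOCK TERM**: `‖aL^{d+1}(Q♯(V)Q(U) − Q♯(U₀ᴴ)Q(U₀))‖ ≤ a·((1+ε)^{2D} − 1)` — `η`-uniform on BAŁABAN's SCALE `ε = s∕L`, `D = (d+1)(L−1)`
(`(1+s∕L)^{2(d+1)(L−1)} ≤ e^{2(d+1)s}`, PART Ϩ-e). [cite: Balaban1985BackgroundPropagators, (3.24) p.394, (3.50) p.400] -/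
theorem l2_opNorm_cxBlockTerm_sub_le {D : ℕ} (hD : ∀ j, T.depth j ≤ D) {a : ℝ} (ha : 0 ≤ a) {U₀ U V : Tor (fine L M) × Fin (d + 1) → Matrix n n 𝕜}
    (hU₀ : ∀ bd, U₀ bd ∈ Matrix.unitaryGroup n 𝕜) {ε : ℝ} (hε0 : 0 ≤ ε) (hU : ∀ bd, ‖U bd - U₀ bd‖ ≤ ε) (hV : ∀ bd, ‖V bd - (U₀ bd)ᴴ‖ ≤ ε) :
    ‖(((a * (L : ℝ) ^ (d + 1) : ℝ)) : 𝕜) • (cxQadj T M V * covQ T M U - cxQadj T M (fun bd => (U₀ bd)ᴴ) * covQ T M U₀)‖ ≤ a * ((1 + ε) ^ (2 * D) - 1) := by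
  have h := l2_opNorm_wtConj_cxBlockTerm_sub_le T M hD ha hU₀ hε0 hU hV (φ := fun _ => (0 : ℝ)) (ϑ := 0) (fun x x' _ => by simp)
  rwa [wtConj_const_zero', Real.exp_zero, one_mul] at h

/-- ★★ WITH THE TREE's WEIGHT `ctW` (block oscillation `κ_w`): `‖(aL^{d+1}(Q♯(V)Q(U) − Q♯(U₀ᴴ)Q(U₀)))_{ctW}‖ ≤ e^{κ_w}·a·((1+ε)^{2D} − 1)`.
[cite: Balaban1985BackgroundPropagators, (3.24) p.394, (3.50) p.400; Dimock2013, App. D, proof of Lemma 30] -/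
theorem l2_opNorm_wtConj_cxBlockTerm_sub_le_ctW {D : ℕ} (hD : ∀ j, T.depth j ≤ D) {a : ℝ} (ha : 0 ≤ a) {U₀ U V : Tor (fine L M) × Fin (d + 1) → Matrix n n 𝕜}
    (hU₀ : ∀ bd, U₀ bd ∈ Matrix.unitaryGroup n 𝕜) {ε : ℝ} (hε0 : 0 ≤ ε) (hU : ∀ bd, ‖U bd - U₀ bd‖ ≤ ε) (hV : ∀ bd, ‖V bd - (U₀ bd)ᴴ‖ ≤ ε) {κw : ℝ} (hκw : 0 ≤ κw)
    (x₀ : Tor (fine L M)) :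
    ‖wtConj (fine L M) (ctW L M κw x₀) ((((a * (L : ℝ) ^ (d + 1) : ℝ)) : 𝕜) • (cxQadj T M V * covQ T M U - cxQadj T M (fun bd => (U₀ bd)ᴴ) * covQ T M U₀))‖
      ≤ Real.exp κw * (a * ((1 + ε) ^ (2 * D) - 1)) :=
  l2_opNorm_wtConj_cxBlockTerm_sub_le T M hD ha hU₀ hε0 hU hV fun x x' h => abs_ctW_block_le L M hκw x₀ x x' h

end Operator

end Summit.QuantumFields.YangMills.BalabanUVNodes.N15KingModelRung.Analytic

end
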